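import Mathlib.Analysis.Calculus.ContDiff.Basic
import Mathlib.Analysis.Calculus.IteratedDeriv.Lemmas
import Mathlib.Analysis.SpecialFunctions.Complex.Circle
import Literature.Analysis.Calculus.IteratedFDerivSymmetric
import Literature.Analysis.Calculus.AnalyticOfFDerivBound
import HarnessLib

/-!
# Wall algebra of the archimedean central-limit functional: `Λ₈ = ¼·(A²N − N³)`

Rogawski, *Automorphic representations of unitary groups in three variables* (1990), §8.4 pp. 126–127,
§12.2: at the archimedean places the stable transfer to the centre `γ₀ = ζ·1` of `U(3)` is read off
from Harish-Chandra's limit formula `lim_{γ → γ₀} ∂(ϖ)[′Δ·Φ_f](γ) = c·f(γ₀)`, `∂(ϖ) = ∏_{α>0} ∂_α`.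
The tree's letter `Literature.NumberTheory.Rogawski1990.ArchCentralLimitFormulaRankTwo` writes
`∂(ϖ) = ∂_{e₀−e₁}∂_{e₀−e₂}∂_{e₁−e₂}` in its *polarised 8-ray form*
`Λ₈[G](z) = (1/48)·Σ_{ε ∈ {±1}³} ε₀ε₁ε₂ · (d/ds)³|₀ G(z·e^{isV_ε})`, `V_ε = ε₀u₁ + ε₁u₂ + ε₂u₃`,
`u₁ = (1,−1,0)`, `u₂ = (1,0,−1)`, `u₃ = (0,1,−1)`.

This file proves the **wall algebra** of that functional, the identity used when the limit
`z → ζ·1` is computed through the *compact wall* `{z₀ = z₁}` (Harish-Chandra's method of descent to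
the centraliser `U(2) × U(1)` of a wall point): with the wall-normal coroot vector `N⃗ = (1,−1,0)` and
the wall-tangent vector `A⃗ = u₂ + u₃ = (1,1,−2)` one has `u₂ = ½(N⃗ + A⃗)`, `u₃ = ½(A⃗ − N⃗)`, hence for
every symmetric trilinear form `m`
  `Σ_ε ε₀ε₁ε₂ · m(V_ε, V_ε, V_ε) = 12·(m(A⃗, A⃗, N⃗) − m(N⃗, N⃗, N⃗))`,
and therefore, for `G` smooth near the torus point `z` (Taylor's formula along the rays and the
symmetry of third derivatives, ★ `Literature.Analysis.Calculus.IteratedFDerivSymmetric`),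
  `Λ₈[G](z) = ¼·(D³g(0)[A⃗, A⃗, N⃗] − D³g(0)[N⃗, N⃗, N⃗])`, `g(θ) := G(z·e^{iθ})`,
i.e. `∂_{u₁}∂_{u₂}∂_{u₃} = ¼·(A²N − N³)` as constant-coefficient operators on the torus: the
functional is a quarter of (the second *tangential* derivative along the wall of the first *normal*
derivative) minus (the third normal derivative). Both readings are supplied in line-derivative
currency: `D³g(0)[N⃗,N⃗,N⃗] = (d/ds)³|₀ G(z·e^{isN⃗})` and
`D³g(0)[A⃗,A⃗,N⃗] = (d/dt)²|₀ (d/ds)|₀ G(z·e^{i(tA⃗ + sN⃗)})`.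

Contents:
* §0 `sum_fin3_bool` — the eight-term enumeration of `Σ_{ε : Fin 3 → Bool}`;
* §1 slot linearity / transposition symmetry helpers, the binary cubic expansion `cube_expand_of_symmetric`,
  and the polarisation identity `sum_sign_cube_signedRay_eq_of_symmetric` (pure multilinear algebra);
* §2 the torus heads `lambda8_eq_quarter_wall_form`, `iteratedFDeriv_three_normal_eq_iteratedDeriv_ray`,
  `iteratedFDeriv_tangent_tangent_normal_eq_iteratedDeriv_deriv`.

All statements are `ρ′Δ`-agnostic (instantiate `G := ρ′Δ·Φ` for the letter's normalised orbital
integral) and local (`ContDiffOn ℝ ∞` on an open set of angles containing `0`, e.g. the regular set).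
-/

namespace Literature.NumberTheory.Rogawski1990

open scoped BigOperators ContDiff Topology
open Literature.Analysis.Calculus

/-! ## §0 Enumerating the eight sign patterns -/

section Enumeration

/-- The eight elements of `Fin 3 → Bool`, listed. [cite: Rogawski1990, §8.4 p. 126] -/
theorem univ_fin3_bool :
    (Finset.univ : Finset (Fin 3 → Bool)) = {![true, true, true], ![true, true, false], ![true, false, true], ![true, false, false],
      ![false, true, true], ![false, true, false], ![false, false, true], ![false, false, false]} := by
  symm
  refine Finset.eq_univ_iff_forall.2 fun ε => ?_
  have hε : ε = ![ε 0, ε 1, ε 2] := by funext i; fin_cases i <;> rfl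
  rw [hε]
  cases ε 0 <;> cases ε 1 <;> cases ε 2 <;> simp

/-- Eight-term expansion of a sum over the sign patterns `ε : Fin 3 → Bool`. [cite: Rogawski1990, §8.4 p. 126] -/
theorem sum_fin3_bool {M : Type*} [AddCommMonoid M] (f : (Fin 3 → Bool) → M) :
    ∑ ε, f ε = f ![true, true, true] + f ![true, true, false] + f ![true, false, true] + f ![true, false, false]
      + f ![false, true, true] + f ![false, true, false] + f ![false, false, true] + f ![false, false, false] := by
  rw [univ_fin3_bool]
  repeat rw [Finset.sum_insert (by simp)]
  rw [Finset.sum_singleton]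
  simp only [add_assoc]

end Enumeration

/-! ## §1 Polarisation algebra for a symmetric trilinear form -/

section Polarisation

variable {E : Type*} [NormedAddCommGroup E] [NormedSpace ℝ E]

/-- Additivity of a trilinear form in its first slot, `![·, y, z]` form. [cite: Rogawski1990, §8.4 p. 126] -/
theorem trilinear_slot0_add (m : ContinuousMultilinearMap ℝ (fun _ : Fin 3 => E) ℂ) (a b y z : E) :
    m ![a + b, y, z] = m ![a, y, z] + m ![b, y, z] := by
  show m (Fin.cons (a + b) ![y, z]) = m (Fin.cons a ![y, z]) + m (Fin.cons b ![y, z])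
  exact m.toMultilinearMap.cons_add ![y, z] a b

/-- Real homogeneity of a trilinear form in its first slot, `![·, y, z]` form. [cite: Rogawski1990, §8.4 p. 126] -/
theorem trilinear_slot0_smul (m : ContinuousMultilinearMap ℝ (fun _ : Fin 3 => E) ℂ) (c : ℝ) (a y z : E) :
    m ![c • a, y, z] = (c : ℂ) * m ![a, y, z] := by
  have h : m (Fin.cons (c • a) ![y, z]) = c • m (Fin.cons a ![y, z]) := m.toMultilinearMap.cons_smul ![y, z] c a
  rw [← Complex.real_smul]
  exact h

/-- A symmetric trilinear form is invariant under the transposition of its first two slots. [cite: Rogawski1990, §8.4 p. 126] -/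
theorem trilinear_swap01_of_symmetric (m : ContinuousMultilinearMap ℝ (fun _ : Fin 3 => E) ℂ)
    (hsym : ∀ (v : Fin 3 → E) (σ : Equiv.Perm (Fin 3)), m (v ∘ σ) = m v) (x y z : E) :
    m ![x, y, z] = m ![y, x, z] := by
  have h := hsym ![y, x, z] (Equiv.swap 0 1)
  have hv : (![y, x, z] ∘ (Equiv.swap (0 : Fin 3) 1)) = ![x, y, z] := by
    funext k; fin_cases k <;> simp [Equiv.swap_apply_of_ne_of_ne]
  rw [hv] at h
  exact h

/-- A symmetric trilinear form is invariant under the transposition of its last two slots. [cite: Rogawski1990, §8.4 p. 126] -/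
theorem trilinear_swap12_of_symmetric (m : ContinuousMultilinearMap ℝ (fun _ : Fin 3 => E) ℂ)
    (hsym : ∀ (v : Fin 3 → E) (σ : Equiv.Perm (Fin 3)), m (v ∘ σ) = m v) (x y z : E) :
    m ![x, y, z] = m ![x, z, y] := by
  have h := hsym ![x, z, y] (Equiv.swap 1 2)
  have hv : (![x, z, y] ∘ (Equiv.swap (1 : Fin 3) 2)) = ![x, y, z] := by
    funext k; fin_cases k <;> simp [Equiv.swap_apply_of_ne_of_ne]
  rw [hv] at h
  exact h

/-- A symmetric trilinear form is invariant under the transposition of its outer slots. [cite: Rogawski1990, §8.4 p. 126] -/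
theorem trilinear_swap02_of_symmetric (m : ContinuousMultilinearMap ℝ (fun _ : Fin 3 => E) ℂ)
    (hsym : ∀ (v : Fin 3 → E) (σ : Equiv.Perm (Fin 3)), m (v ∘ σ) = m v) (x y z : E) :
    m ![x, y, z] = m ![z, y, x] := by
  have h := hsym ![z, y, x] (Equiv.swap 0 2)
  have hv : (![z, y, x] ∘ (Equiv.swap (0 : Fin 3) 2)) = ![x, y, z] := by
    funext k; fin_cases k <;> simp [Equiv.swap_apply_of_ne_of_ne]
  rw [hv] at h
  exact h

/-- **Binary cubic expansion.** For a symmetric trilinear form `m` and `w = α•N + β•A`: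
`m(w,w,w) = α³·m(N,N,N) + 3α²β·m(N,N,A) + 3αβ²·m(N,A,A) + β³·m(A,A,A)`. [cite: Rogawski1990, §8.4 p. 126] -/
theorem cube_expand_of_symmetric (m : ContinuousMultilinearMap ℝ (fun _ : Fin 3 => E) ℂ)
    (hsym : ∀ (v : Fin 3 → E) (σ : Equiv.Perm (Fin 3)), m (v ∘ σ) = m v) (N A : E) (α β : ℝ) :
    m ![α • N + β • A, α • N + β • A, α • N + β • A] =
      (α : ℂ) ^ 3 * m ![N, N, N] + 3 * (α : ℂ) ^ 2 * β * m ![N, N, A] + 3 * α * (β : ℂ) ^ 2 * m ![N, A, A]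
        + (β : ℂ) ^ 3 * m ![A, A, A] := by
  have e0 : ∀ y z, m ![α • N + β • A, y, z] = (α : ℂ) * m ![N, y, z] + (β : ℂ) * m ![A, y, z] := fun y z => by
    rw [trilinear_slot0_add, trilinear_slot0_smul, trilinear_slot0_smul]
  have e1 : ∀ x z, m ![x, α • N + β • A, z] = (α : ℂ) * m ![x, N, z] + (β : ℂ) * m ![x, A, z] := fun x z => by
    rw [trilinear_swap01_of_symmetric m hsym x _ z, e0, trilinear_swap01_of_symmetric m hsym N x z,
      trilinear_swap01_of_symmetric m hsym A x z]
  have e2 : ∀ x y, m ![x, y, α • N + β • A] = (α : ℂ) * m ![x, y, N] + (β : ℂ) * m ![x, y, A] := fun x y => by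
    rw [trilinear_swap02_of_symmetric m hsym x y _, e0, trilinear_swap02_of_symmetric m hsym N y x,
      trilinear_swap02_of_symmetric m hsym A y x]
  rw [e0, e1, e1, e2, e2, e2, e2, trilinear_swap12_of_symmetric m hsym N A N, trilinear_swap02_of_symmetric m hsym A N N,
    trilinear_swap01_of_symmetric m hsym A N A, trilinear_swap02_of_symmetric m hsym A A N]
  ring

/-- **Wall polarisation of the 8-ray functional (pure algebra).** For a symmetric trilinear form `m` on
`ℝ³` and the letter's signed rays `V_ε = ![ε₀+ε₁, −ε₀+ε₂, −ε₁−ε₂] = (ε₀ + (ε₁−ε₂)/2)•N⃗ + ((ε₁+ε₂)/2)•A⃗`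
(`N⃗ = (1,−1,0)`, `A⃗ = (1,1,−2)`):
`Σ_ε ε₀ε₁ε₂·m(V_ε,V_ε,V_ε) = 12·(m(A⃗,A⃗,N⃗) − m(N⃗,N⃗,N⃗))` — i.e. `∂_{u₁}∂_{u₂}∂_{u₃} = ¼(A²N − N³)`
after the letter's normalisation `1/48`. [cite: Rogawski1990, §8.4 p. 126] -/
theorem sum_sign_cube_signedRay_eq_of_symmetric (m : ContinuousMultilinearMap ℝ (fun _ : Fin 3 => (Fin 3 → ℝ)) ℂ)
    (hsym : ∀ (v : Fin 3 → (Fin 3 → ℝ)) (σ : Equiv.Perm (Fin 3)), m (v ∘ σ) = m v) :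
    ∑ ε : Fin 3 → Bool, (((if ε 0 then (1 : ℝ) else -1) * (if ε 1 then (1 : ℝ) else -1) * (if ε 2 then (1 : ℝ) else -1) : ℝ) : ℂ) *
        m (fun _ => ![(if ε 0 then (1 : ℝ) else -1) + (if ε 1 then (1 : ℝ) else -1), -(if ε 0 then (1 : ℝ) else -1) + (if ε 2 then (1 : ℝ) else -1),
          -(if ε 1 then (1 : ℝ) else -1) - (if ε 2 then (1 : ℝ) else -1)]) =
      12 * (m ![![1, 1, -2], ![1, 1, -2], ![1, -1, 0]] - m ![![1, -1, 0], ![1, -1, 0], ![1, -1, 0]]) := by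
  have hray : ∀ ε : Fin 3 → Bool,
      (fun _ : Fin 3 => ![(if ε 0 then (1 : ℝ) else -1) + (if ε 1 then (1 : ℝ) else -1), -(if ε 0 then (1 : ℝ) else -1) + (if ε 2 then (1 : ℝ) else -1),
          -(if ε 1 then (1 : ℝ) else -1) - (if ε 2 then (1 : ℝ) else -1)]) =
        ![((if ε 0 then (1 : ℝ) else -1) + ((if ε 1 then (1 : ℝ) else -1) - (if ε 2 then (1 : ℝ) else -1)) / 2) • (![1, -1, 0] : Fin 3 → ℝ)
            + (((if ε 1 then (1 : ℝ) else -1) + (if ε 2 then (1 : ℝ) else -1)) / 2) • (![1, 1, -2] : Fin 3 → ℝ),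
          ((if ε 0 then (1 : ℝ) else -1) + ((if ε 1 then (1 : ℝ) else -1) - (if ε 2 then (1 : ℝ) else -1)) / 2) • (![1, -1, 0] : Fin 3 → ℝ)
            + (((if ε 1 then (1 : ℝ) else -1) + (if ε 2 then (1 : ℝ) else -1)) / 2) • (![1, 1, -2] : Fin 3 → ℝ),
          ((if ε 0 then (1 : ℝ) else -1) + ((if ε 1 then (1 : ℝ) else -1) - (if ε 2 then (1 : ℝ) else -1)) / 2) • (![1, -1, 0] : Fin 3 → ℝ)
            + (((if ε 1 then (1 : ℝ) else -1) + (if ε 2 then (1 : ℝ) else -1)) / 2) • (![1, 1, -2] : Fin 3 → ℝ)] := by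
    intro ε
    funext i
    fin_cases i <;> (funext k; fin_cases k <;> simp <;> ring)
  simp only [hray, cube_expand_of_symmetric m hsym]
  rw [sum_fin3_bool, trilinear_swap02_of_symmetric m hsym ![1, 1, -2] ![1, 1, -2] ![1, -1, 0],
    trilinear_swap02_of_symmetric m hsym ![1, -1, 0] ![1, -1, 0] ![1, 1, -2],
    trilinear_swap12_of_symmetric m hsym ![1, 1, -2] ![1, -1, 0] ![1, -1, 0]]
  simp only [Matrix.cons_val_zero, Matrix.cons_val_one, Matrix.cons_val_two, Matrix.head_cons, Matrix.tail_cons,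
    if_true, Bool.false_eq_true, if_false]
  push_cast
  ring

end Polarisation

/-! ## §2 The torus heads -/

section Torus

/-- Line restriction of the angle chart: `(d/ds)ᵏ|₀ G(z·e^{isV}) = Dᵏg(0)[V,…,V]` for
`g(θ) = G(z·e^{iθ})` smooth on an open set of angles containing `0`. [cite: Rogawski1990, §8.4 p. 126] -/
theorem iteratedDeriv_ray_eq_iteratedFDeriv_chart (G : (Fin 3 → Circle) → ℂ) (z : Fin 3 → Circle) {U : Set (Fin 3 → ℝ)}
    (hU : IsOpen U) (h0 : (0 : Fin 3 → ℝ) ∈ U)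
    (hg : ContDiffOn ℝ ∞ (fun θ : Fin 3 → ℝ => G (fun k => z k * Circle.exp (θ k))) U) (V : Fin 3 → ℝ) (n : ℕ) :
    iteratedDeriv n (fun s : ℝ => G (fun k => z k * Circle.exp (s * V k))) 0 =
      iteratedFDeriv ℝ n (fun θ : Fin 3 → ℝ => G (fun k => z k * Circle.exp (θ k))) 0 (fun _ => V) := by
  have h := iteratedDeriv_comp_line hU hg 0 V (t := 0) (by simpa using h0) n
  simpa only [zero_add, zero_smul, Pi.smul_apply, smul_eq_mul] using h

/-- **(R1) Normal cube reading**: `D³g(0)[N⃗,N⃗,N⃗] = (d/ds)³|₀ G(z·e^{isN⃗})`, `N⃗ = (1,−1,0)`. [cite: Rogawski1990, §8.4 p. 126] -/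
theorem iteratedFDeriv_three_normal_eq_iteratedDeriv_ray (G : (Fin 3 → Circle) → ℂ) (z : Fin 3 → Circle) {U : Set (Fin 3 → ℝ)}
    (hU : IsOpen U) (h0 : (0 : Fin 3 → ℝ) ∈ U)
    (hg : ContDiffOn ℝ ∞ (fun θ : Fin 3 → ℝ => G (fun k => z k * Circle.exp (θ k))) U) :
    iteratedFDeriv ℝ 3 (fun θ : Fin 3 → ℝ => G (fun k => z k * Circle.exp (θ k))) 0 ![![1, -1, 0], ![1, -1, 0], ![1, -1, 0]] =
      iteratedDeriv 3 (fun s : ℝ => G (fun k => z k * Circle.exp (s * (![1, -1, 0] : Fin 3 → ℝ) k))) 0 := by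
  rw [iteratedDeriv_ray_eq_iteratedFDeriv_chart G z hU h0 hg]
  congr 1
  funext i
  fin_cases i <;> rfl

/-- **(R2) Tangent–tangent–normal reading**: `D³g(0)[A⃗,A⃗,N⃗] = (d/dt)²|₀ (d/ds)|₀ G(z·e^{i(tA⃗+sN⃗)})` —
the second derivative along the wall direction `A⃗ = (1,1,−2)` of the first wall-normal derivative
(`N⃗ = (1,−1,0)`). [cite: Rogawski1990, §8.4 p. 126] -/
theorem iteratedFDeriv_tangent_tangent_normal_eq_iteratedDeriv_deriv (G : (Fin 3 → Circle) → ℂ) (z : Fin 3 → Circle)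
    {U : Set (Fin 3 → ℝ)} (hU : IsOpen U) (h0 : (0 : Fin 3 → ℝ) ∈ U)
    (hg : ContDiffOn ℝ ∞ (fun θ : Fin 3 → ℝ => G (fun k => z k * Circle.exp (θ k))) U) :
    iteratedFDeriv ℝ 3 (fun θ : Fin 3 → ℝ => G (fun k => z k * Circle.exp (θ k))) 0 ![![1, 1, -2], ![1, 1, -2], ![1, -1, 0]] =
      iteratedDeriv 2 (fun t : ℝ => deriv (fun s : ℝ =>
        G (fun k => z k * Circle.exp (t * (![1, 1, -2] : Fin 3 → ℝ) k + s * (![1, -1, 0] : Fin 3 → ℝ) k))) 0) 0 := by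
  set g : (Fin 3 → ℝ) → ℂ := fun θ => G (fun k => z k * Circle.exp (θ k)) with hgdef
  set A : Fin 3 → ℝ := ![1, 1, -2] with hA
  set N : Fin 3 → ℝ := ![1, -1, 0] with hN
  -- `φ y := Dg(y)[N⃗]` is smooth on `U`
  have hfd : ContDiffOn ℝ ∞ (fderiv ℝ g) U := ((contDiffOn_infty_iff_fderiv_of_isOpen hU).1 hg).2
  have hφ : ContDiffOn ℝ ∞ (fun y => fderiv ℝ g y N) U := hfd.clm_apply contDiffOn_const
  -- step (a): near `t = 0`, `(d/ds)|₀ g(tA + sN) = φ(tA)`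
  have hmem : ∀ᶠ t : ℝ in 𝓝 0, t • A ∈ U := by
    have hc : Continuous fun t : ℝ => t • A := continuous_id.smul continuous_const
    have : (fun t : ℝ => t • A) ⁻¹' U ∈ 𝓝 (0 : ℝ) := hc.continuousAt.preimage_mem_nhds (by simpa using hU.mem_nhds h0)
    exact this
  have hev : (fun t : ℝ => deriv (fun s : ℝ => G (fun k => z k * Circle.exp (t * A k + s * N k))) 0) =ᶠ[𝓝 0]
      fun t => (fun y => fderiv ℝ g y N) (0 + t • A) := by
    filter_upwards [hmem] with t ht
    have h1 := iteratedDeriv_comp_line hU hg (t • A) N (t := 0) (by simpa using ht) 1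
    rw [iteratedDeriv_one, zero_smul, add_zero, iteratedFDeriv_one_apply] at h1
    have hfun : (fun s : ℝ => G (fun k => z k * Circle.exp (t * A k + s * N k))) = fun s => g (t • A + s • N) := by
      funext s
      simp only [hgdef, Pi.add_apply, Pi.smul_apply, smul_eq_mul]
    rw [hfun, zero_add]
    exact h1
  rw [hev.iteratedDeriv_eq 2, iteratedDeriv_comp_line hU hφ 0 A (t := 0) (by simpa using h0) 2]
  simp only [zero_smul, add_zero]
  -- step (b): `D²φ(0)[A,A] = D²(Dg)(0)[A,A] N`
  rw [← iteratedFDerivWithin_of_isOpen 2 hU h0, ← iteratedFDerivWithin_of_isOpen 3 hU h0,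
    iteratedFDerivWithin_clm_apply_const_apply hU.uniqueDiffOn hfd (by exact_mod_cast ENat.natCast_le_of_coe_top_le_withTop le_rfl 2) h0,
    iteratedFDerivWithin_of_isOpen 2 hU h0, iteratedFDerivWithin_of_isOpen 3 hU h0]
  -- step (c): `D³g(0)[A,A,N] = D²(Dg)(0)[A,A] N`
  rw [iteratedFDeriv_succ_apply_right]
  have hi : Fin.init ![A, A, N] = fun _ : Fin 2 => A := by funext i; fin_cases i <;> rfl
  have hl : ![A, A, N] (Fin.last 2) = N := rfl
  rw [hi, hl]

/-- **THE WALL FORM OF THE CENTRAL-LIMIT FUNCTIONAL.** For `G` smooth near the torus point `z`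
(precisely: `g(θ) = G(z·e^{iθ})` is `C^∞` on an open set of angles containing `0`), the letter's 8-ray
functional equals a quarter of `D³g(0)[A⃗,A⃗,N⃗] − D³g(0)[N⃗,N⃗,N⃗]`, `N⃗ = (1,−1,0)` the coroot vector
normal to the compact wall `{z₀ = z₁}`, `A⃗ = (1,1,−2)` tangent to it:
`Λ₈[G](z) = ¼·(A²N − N³)g(0)`. [cite: Rogawski1990, §8.4 pp. 126–127] -/
theorem lambda8_eq_quarter_wall_form (G : (Fin 3 → Circle) → ℂ) (z : Fin 3 → Circle) {U : Set (Fin 3 → ℝ)}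
    (hU : IsOpen U) (h0 : (0 : Fin 3 → ℝ) ∈ U)
    (hg : ContDiffOn ℝ ∞ (fun θ : Fin 3 → ℝ => G (fun k => z k * Circle.exp (θ k))) U) :
    (1 / 48 : ℂ) * ∑ ε : Fin 3 → Bool, (((if ε 0 then (1 : ℝ) else -1) * (if ε 1 then (1 : ℝ) else -1) * (if ε 2 then (1 : ℝ) else -1) : ℝ) : ℂ) *
        iteratedDeriv 3 (fun s : ℝ => G
          (fun k => z k * Circle.exp (s * ![(if ε 0 then (1 : ℝ) else -1) + (if ε 1 then (1 : ℝ) else -1), -(if ε 0 then (1 : ℝ) else -1) + (if ε 2 then (1 : ℝ) else -1),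
            -(if ε 1 then (1 : ℝ) else -1) - (if ε 2 then (1 : ℝ) else -1)] k))) 0 =
      (1 / 4 : ℂ) * (iteratedFDeriv ℝ 3 (fun θ : Fin 3 → ℝ => G (fun k => z k * Circle.exp (θ k))) 0 ![![1, 1, -2], ![1, 1, -2], ![1, -1, 0]]
        - iteratedFDeriv ℝ 3 (fun θ : Fin 3 → ℝ => G (fun k => z k * Circle.exp (θ k))) 0 ![![1, -1, 0], ![1, -1, 0], ![1, -1, 0]]) := by
  simp only [iteratedDeriv_ray_eq_iteratedFDeriv_chart G z hU h0 hg]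
  have hsym : ∀ (v : Fin 3 → (Fin 3 → ℝ)) (σ : Equiv.Perm (Fin 3)),
      iteratedFDeriv ℝ 3 (fun θ : Fin 3 → ℝ => G (fun k => z k * Circle.exp (θ k))) 0 (v ∘ σ) =
        iteratedFDeriv ℝ 3 (fun θ : Fin 3 → ℝ => G (fun k => z k * Circle.exp (θ k))) 0 v := fun v σ =>
    iteratedFDeriv_comp_perm_of_le (𝕜 := ℝ) (hg.contDiffAt (hU.mem_nhds h0)) (by exact_mod_cast ENat.natCast_le_of_coe_top_le_withTop le_rfl 3) v σ
  rw [sum_sign_cube_signedRay_eq_of_symmetric _ hsym]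
  ring

/-- **Wall form in line-derivative currency**: `Λ₈[G](z) = ¼·((d/dt)²|₀(d/ds)|₀ G(z·e^{i(tA⃗+sN⃗)}) − (d/ds)³|₀ G(z·e^{isN⃗}))`.
[cite: Rogawski1990, §8.4 pp. 126–127] -/
theorem lambda8_eq_quarter_wall_jets (G : (Fin 3 → Circle) → ℂ) (z : Fin 3 → Circle) {U : Set (Fin 3 → ℝ)}
    (hU : IsOpen U) (h0 : (0 : Fin 3 → ℝ) ∈ U)
    (hg : ContDiffOn ℝ ∞ (fun θ : Fin 3 → ℝ => G (fun k => z k * Circle.exp (θ k))) U) :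
    (1 / 48 : ℂ) * ∑ ε : Fin 3 → Bool, (((if ε 0 then (1 : ℝ) else -1) * (if ε 1 then (1 : ℝ) else -1) * (if ε 2 then (1 : ℝ) else -1) : ℝ) : ℂ) *
        iteratedDeriv 3 (fun s : ℝ => G
          (fun k => z k * Circle.exp (s * ![(if ε 0 then (1 : ℝ) else -1) + (if ε 1 then (1 : ℝ) else -1), -(if ε 0 then (1 : ℝ) else -1) + (if ε 2 then (1 : ℝ) else -1),
            -(if ε 1 then (1 : ℝ) else -1) - (if ε 2 then (1 : ℝ) else -1)] k))) 0 =
      (1 / 4 : ℂ) * (iteratedDeriv 2 (fun t : ℝ => deriv (fun s : ℝ =>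
          G (fun k => z k * Circle.exp (t * (![1, 1, -2] : Fin 3 → ℝ) k + s * (![1, -1, 0] : Fin 3 → ℝ) k))) 0) 0
        - iteratedDeriv 3 (fun s : ℝ => G (fun k => z k * Circle.exp (s * (![1, -1, 0] : Fin 3 → ℝ) k))) 0) := by
  rw [lambda8_eq_quarter_wall_form G z hU h0 hg, iteratedFDeriv_tangent_tangent_normal_eq_iteratedDeriv_deriv G z hU h0 hg,
    iteratedFDeriv_three_normal_eq_iteratedDeriv_ray G z hU h0 hg]

end Torus

end Literature.NumberTheory.Rogawski1990
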